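import Summits.ResolutionOfSingularities.ResolutionOfSingularities.Theorems.MarkedTransferCampaignW46FiniteExitBoundNodes
import Mathlib.AlgebraicGeometry.Morphisms.FiniteType
import HarnessLib

/-!
# [OURS · L1 W4.6 rung (i-a)′] Dictionary, supplement: the root germ is ESSENTIALLY OF FINITE TYPE over the base field
# (cell res-hironaka, LADDER-RESOLUTION rung L, D-0089; campaign s46, seat res-D-pv-046 AS res-L1-s46-pv-9; host route MarkedTransfer,
# `--supports stmt-ResolutionOfSingularities-16156 --as helper`)

HONEST FRAMING. Nothing here is a statement of H. Hironaka's manuscript (2017-03-23, [Hironaka2017]). A Mathlib assembly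
(`LocallyOfFiniteType.stalkMap`: stalks of a scheme locally of finite type are essentially of finite type over the stalks of the
base) read for an ambient datum of the campaign: the excellence-type input which the scheme-anchored form of Theorem A
(`planeIsolatedFinLocalExitBound_of_noInfiniteMarkedBranchAt`, p505617) may consume — e.g. finiteness of normalisations of the curve
germs `𝒪_{Z,ξ}/𝔭` (tree `IntegralClosureEssFiniteType.lean`). AI review is weaker than expert review. No `sorry`; axioms standard.

* `exists_essFiniteType_stalk` — for an ambient datum `A` over `K` and any point `ξ`, there is a ring homomorphism `K → 𝒪_{Z,ξ}`
  (the structure map) which is essentially of finite type.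
* `exists_essFiniteType_range_stalk` — the same for the root ring `(𝒪_{Z,ξ} → K(Z)).range` of the marked quadratic tree.
-/

noncomputable section

set_option linter.dupNamespace false -- mandated namespace of this single-conjunct summit

open CategoryTheory AlgebraicGeometry TopologicalSpace IsLocalRing

namespace Summit.ResolutionOfSingularities.ResolutionOfSingularities.Theorems

namespace CampaignW46

open Literature.AlgebraicGeometry.Resolution
open Literature.AlgebraicGeometry.Hironaka2017.S02Preliminaries

universe u

variable {p : ℕ} [Fact p.Prime] {K : Type u} [Field K] [CharP K p]

/-- The germ map `K = Γ(Spec K) → 𝒪_{Spec K, x}` is surjective (a one-point space: every germ is a global section). [folklore] -/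
theorem germ_spec_field_surjective (x : Spec (CommRingCat.of K)) :
    Function.Surjective (((Spec (CommRingCat.of K)).presheaf.germ ⊤ x trivial).hom.comp
      (Scheme.ΓSpecIso (CommRingCat.of K)).inv.hom) := by
  intro s
  obtain ⟨U, hxU, t, ht⟩ := (Spec (CommRingCat.of K)).presheaf.exists_germ_eq (x := x) s
  have hU : U = ⊤ := by
    ext y
    simp only [Opens.coe_top, Set.mem_univ, iff_true]
    have : y = x := Subsingleton.elim _ _
    rw [this]; exact hxU
  subst hU
  refine ⟨(Scheme.ΓSpecIso (CommRingCat.of K)).hom.hom t, ?_⟩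
  have h1 : (Scheme.ΓSpecIso (CommRingCat.of K)).inv.hom ((Scheme.ΓSpecIso (CommRingCat.of K)).hom.hom t) = t := by
    rw [← CommRingCat.comp_apply, Iso.hom_inv_id, CommRingCat.id_apply]
  rw [RingHom.comp_apply, h1]
  exact ht

/-- **The stalks of an ambient datum are essentially of finite type over the base field**: the structure map
`K → 𝒪_{Z,ξ}` (through `Spec K`) is `RingHom.EssFiniteType` (Mathlib `LocallyOfFiniteType.stalkMap`). [folklore] -/
theorem exists_essFiniteType_stalk (A : AmbientDatum p K) (ξ : A.Z) :
    ∃ φ : K →+* A.Z.presheaf.stalk ξ, φ.EssFiniteType := by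
  haveI := A.smooth
  let ψ₀ : K →+* (Spec (CommRingCat.of K)).presheaf.stalk (A.hom ξ) :=
    (((Spec (CommRingCat.of K)).presheaf.germ ⊤ (A.hom ξ) trivial).hom).comp (Scheme.ΓSpecIso (CommRingCat.of K)).inv.hom
  have hψ₀ : ψ₀.EssFiniteType :=
    (RingHom.FiniteType.of_surjective ψ₀ (germ_spec_field_surjective (A.hom ξ))).essFiniteType
  exact ⟨(A.hom.stalkMap ξ).hom.comp ψ₀, RingHom.EssFiniteType.comp hψ₀ (LocallyOfFiniteType.stalkMap (f := A.hom) ξ)⟩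

/-- The root ring of the marked quadratic tree, `(𝒪_{Z,ξ} → K(Z)).range ≅ 𝒪_{Z,ξ}`, is essentially of finite type over the base
field. [folklore] -/
theorem exists_essFiniteType_range_stalk (A : AmbientDatum p K) (ξ : A.Z) :
    haveI := ambient_isIntegral A
    ∃ φ : K →+* (algebraMap (A.Z.presheaf.stalk ξ) A.Z.functionField).range, φ.EssFiniteType := by
  haveI := ambient_isIntegral A
  obtain ⟨φ, hφ⟩ := exists_essFiniteType_stalk A ξ
  set ι := algebraMap (A.Z.presheaf.stalk ξ) A.Z.functionField
  have hsurj : Function.Surjective ι.rangeRestrict := ι.rangeRestrict_surjective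
  exact ⟨ι.rangeRestrict.comp φ,
    RingHom.EssFiniteType.comp hφ (RingHom.FiniteType.of_surjective _ hsurj).essFiniteType⟩

end CampaignW46

end Summit.ResolutionOfSingularities.ResolutionOfSingularities.Theorems

end
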